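import Literature.AlgebraicGeometry.VanGeemen1994.HyperbolicOfSplitDiscriminant
import Summits.HodgeConjecture.HodgeConjecture.Theorems.Ring2AbelianAllWeilFieldCM
import Mathlib.RingTheory.Norm.Transitivity
import HarnessLib

/-!
# Ring 2 · AbelianAll (ab-weil-2, gen 5) — ODD-DEGREE NORM DESCENT for the Weil discriminant:
# a discriminant witnessed as a relative CM norm from an odd-degree field is the SPLIT class

research route, not a corollary; conditional on HC_CM plus one named minimal statement.
Cell line: research route conditional on HC_CM; not a corollary; Q11.4-sentence-2 already refuted in dim ≥ 3.
`HC_CM` (`Theses.RankFourFaces.CMAbelianHodge`) does not occur in this file; no case of the Hodge conjecture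
is claimed. This is the ARITHMETIC HALF of Theorem D of `pub-hodge-ring2-ab-weil-2/WEIL-CELLS.md` §R14
("Schoen-algebraic ⟹ split" for the prime-conductor Hecke–Prym mechanism): the topological half (a cyclic
action with simple branch data bounds, so the `E = ℚ(ζ_p)`-Prym is `E`-hyperbolic and `(-1)ⁿ det H` is a
relative norm from `E` to `E⁺`, `[E⁺ : ℚ] = (p - 1)/2` odd) lives on paper (no cover carriers in the tree);
what the kernel checks here is the step that needs no class field theory:

* §1 `exists_norm_eq_of_norm_eq_pow_odd`: over a quadratic extension `K/F`, if `d^(2k+1)` is a norm then `d`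
  is a norm (`d = Nm(w · d^{-k})`).
* §1 `norm_norm_eq_pow_of_norm_eq_algebraMap`: in a diagram of fields `F ⊂ K ⊂ E`, `F ⊂ P ⊂ E`, an element
  `z ∈ E` with `N_{E/P}(z) = d ∈ F` has `N_{K/F}(N_{E/K}(z)) = d^{[P:F]}` (transitivity of the norm both ways).
* §1 `exists_norm_eq_of_odd_degree`: hence if `[K:F] = 2` and `[P:F]` is ODD, `d` is a norm from `K`.
* §2 ON THE CARRIERS (`VanGeemen1994.HasWeilDiscriminantNondeg`, `Motives.IsHyperbolicWeilType`): a Weil-type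
  `(A, φ)` of dimension `2n` over `K_d = ℚ(√-d)` whose discriminant witness `q` has `(-1)ⁿ q = N_{E/P}(z)` for
  some tower `ℚ ⊂ K_d ⊂ E ⊃ P ⊃ ℚ` with `[P : ℚ]` odd is of SPLIT (hyperbolic) Weil type
  (`isHyperbolicWeilType_of_hasWeilDiscriminantNondeg_of_oddDegreeNorm`) — Landherr's converse
  (`VanGeemen1994.isHyperbolicWeilType_of_hasWeilDiscriminantNondeg_split`, a tree THEOREM) does the rest.

For the Hecke–Prym pieces of `G_K = ℤ/p ⋊ C_{(p-1)/2}`-curves (`p ≡ 3 (4)`, `E = ℚ(ζ_p)`, `P = E⁺`) this is the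
statement "the `ℚ(√-p)`-piece is split as soon as the `E`-Prym is `E`-hyperbolic"; see §R14 for the topology.

References: [vanGeemen1994HodgeAV] B. van Geemen, LNM 1594 (1994), 4.14, Lemma 5.2, 5.4 and (5.4.1);
[Landherr1936HermitianForms]; [Schoen1988HodgeWeil] C. Schoen, Compositio Math. 65 (1988), Thm 2.0, Cor 3.1.
-/

noncomputable section

set_option linter.dupNamespace false

open CategoryTheory Polynomial
open Literature.AlgebraicGeometry Literature.AlgebraicGeometry.Motives
open Literature.AlgebraicGeometry.HodgeTheory
open Literature.AlgebraicGeometry.VanGeemen1994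

namespace Summit.HodgeConjecture.HodgeConjecture.Ring2.AbelianAll

/-! ### §1 Odd-degree norm descent (pure field arithmetic) -/

section NormDescent

variable {F K : Type*} [Field F] [Field K] [Algebra F K]

/-- Over a QUADRATIC extension `K/F`: if an odd power `d^(2k+1)` of `d ∈ F^×` is a norm from `K`, then `d`
itself is a norm — `d = Nm(w · d^{-k})` because `Nm(d^{-k}) = d^{-2k}`. [folklore] -/
theorem exists_norm_eq_of_norm_eq_pow_odd (h2 : Module.finrank F K = 2) {d : F} (hd : d ≠ 0) {k : ℕ}
    {w : K} (hw : Algebra.norm F w = d ^ (2 * k + 1)) : ∃ w' : K, Algebra.norm F w' = d := by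
  have hk : d ^ k ≠ 0 := pow_ne_zero _ hd
  refine ⟨w * algebraMap F K ((d ^ k)⁻¹), ?_⟩
  rw [map_mul, Algebra.norm_algebraMap, h2, hw]
  field_simp
  ring

variable {P E : Type*} [Field P] [Field E] [Algebra F P] [Algebra F E] [Algebra K E] [Algebra P E]
  [IsScalarTower F K E] [IsScalarTower F P E]

/-- Transitivity of the norm along BOTH towers `F ⊂ K ⊂ E` and `F ⊂ P ⊂ E`: if `N_{E/P}(z) = d ∈ F` then
`N_{K/F}(N_{E/K}(z)) = N_{E/F}(z) = N_{P/F}(d) = d^{[P:F]}`. [folklore] -/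
theorem norm_norm_eq_pow_of_norm_eq_algebraMap {d : F} {z : E}
    (hz : Algebra.norm P z = algebraMap F P d) :
    Algebra.norm F (Algebra.norm K z) = d ^ Module.finrank F P := by
  rw [Algebra.norm_norm (R := F) (S := K), ← Algebra.norm_norm (R := F) (S := P), hz,
    Algebra.norm_algebraMap]

/-- **Odd-degree norm descent.** In a diagram of fields `F ⊂ K ⊂ E`, `F ⊂ P ⊂ E` with `[K : F] = 2` and
`[P : F]` ODD, an element `d ∈ F^×` that is a relative norm `N_{E/P}(z)` is a norm from `K`:
`d^{[P:F]} = N_{K/F}(N_{E/K} z)` and an odd power descends (`exists_norm_eq_of_norm_eq_pow_odd`). This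
replaces Springer's odd-degree theorem / the Hasse norm theorem in Theorem D of WEIL-CELLS §R14. [folklore] -/
theorem exists_norm_eq_of_odd_degree (h2 : Module.finrank F K = 2) (hodd : Odd (Module.finrank F P))
    {d : F} (hd : d ≠ 0) {z : E} (hz : Algebra.norm P z = algebraMap F P d) :
    ∃ w : K, Algebra.norm F w = d := by
  obtain ⟨k, hk⟩ := hodd
  have h := norm_norm_eq_pow_of_norm_eq_algebraMap (K := K) hz
  rw [hk] at h
  exact exists_norm_eq_of_norm_eq_pow_odd h2 hd h

end NormDescent

/-! ### §2 On the carriers: an odd-degree relative-norm witness of the discriminant forces SPLIT Weil type -/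

section Carriers

variable {n d : ℕ} {A : AbelianVariety ℂ} {φ : A ⟶ A}

/-- The class of `q` in `ℚ^×/Nm(K_d^×)` is the split class `[(-1)ⁿ]` as soon as `(-1)ⁿ q` is a norm from
`K_d`: `q⁻¹ (-1)ⁿ = ((-1)ⁿ q) · (q⁻¹)²` and squares of rationals are norms. [cite: vanGeemen1994HodgeAV, 4.14] -/
theorem weilNormResidue_mk_eq_split_of_norm (hd : 0 < d) {q : ℚˣ} {w : weilField d}
    (hw : Algebra.norm ℚ w = (q : ℚ) * (-1) ^ n) :
    (QuotientGroup.mk q : weilNormResidueGroup d) = QuotientGroup.mk ((-1 : ℚˣ) ^ n) := by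
  have hq : ((q : ℚ) * (-1) ^ n) ≠ 0 := mul_ne_zero (Units.ne_zero q) (pow_ne_zero _ (by norm_num))
  -- the rational scalar `q⁻¹ ∈ K_d` and its norm `q⁻²` (stated before any `Field` instance enters)
  set c : weilField d := algebraMap ℚ (weilField d) ((q : ℚ)⁻¹) with hc
  have hnc : Algebra.norm ℚ c = ((q : ℚ)⁻¹) ^ 2 := by
    rw [hc, Algebra.norm_algebraMap, finrank_weilField]
  haveI := fact_irreducible_weilPoly hd
  have hw0 : w ≠ 0 := by
    intro h
    rw [h, Algebra.norm_zero] at hw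
    exact hq hw.symm
  have hc0 : c ≠ 0 := by
    intro h
    rw [h, Algebra.norm_zero] at hnc
    exact (pow_ne_zero 2 (inv_ne_zero (Units.ne_zero q))) hnc.symm
  refine QuotientGroup.eq.2 (mem_normUnitsSubgroup_iff.2 ⟨Units.mk0 w hw0 * Units.mk0 c hc0, ?_⟩)
  rw [Units.val_mul, Units.val_mk0, Units.val_mk0, map_mul, hw, hnc]
  push_cast
  field_simp

/-- **SPLIT from an odd-degree relative-norm witness of the discriminant (arithmetic half of Theorem D,
WEIL-CELLS §R14).** Let `(A, φ)` be an abelian `2n`-fold of Weil type over `K_d = ℚ(√-d)` (a non-zero rational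
`(n,n)` Weil class), polarized by the `K`-symmetrised hyperplane class `h = d·e^*a + φ^*e^*a`, with a
non-degenerate discriminant witness of class `[q]` (`HasWeilDiscriminantNondeg`). If `(-1)ⁿ q` is a relative
norm `N_{E/P}(z)` in some diagram of fields `ℚ ⊂ K_d ⊂ E ⊃ P ⊃ ℚ` with `[P : ℚ]` ODD (for the Hecke–Prym pieces
of `ℤ/p ⋊ C_{(p-1)/2}`-curves: `E = ℚ(ζ_p)`, `P = ℚ(ζ_p)⁺`, `[P:ℚ] = (p-1)/2` odd for `p ≡ 3 (4)`, and the witness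
comes from the `E`-hyperbolicity of the cyclic Prym), then `(A, φ, h)` is of SPLIT (hyperbolic) Weil type:
odd-degree norm descent puts `[q] = [(-1)ⁿ]` and Landherr's converse on the carriers
(`VanGeemen1994.isHyperbolicWeilType_of_hasWeilDiscriminantNondeg_split`) gives a `φ^*`-stable rational
isotropic `2n`-frame. [cite: vanGeemen1994HodgeAV, 5.4 and (5.4.1)] [cite: Landherr1936HermitianForms] -/
theorem isHyperbolicWeilType_of_hasWeilDiscriminantNondeg_of_oddDegreeNorm (hn : 0 < n)
    (hA : A.dim = 2 * n) (hd : 0 < d) (hφ : φ ≫ φ = -(d • 𝟙 A)) (e : ProjectiveEmbedding A.X)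
    {a : complexBetti (projectiveSpace e.n ℂ) 2} (ha : IsRationalClass a) (ha0 : a ≠ 0)
    (hweil : ∃ c ∈ weilClassesOf A φ n d,
      IsRationalClass c ∧ IsOfHodgeType (2 * n) A.X (2 * n) n n c ∧ c ≠ 0)
    {q : ℚˣ}
    (hδ : HasWeilDiscriminantNondeg A φ n d
      ((d : ℂ) • complexBetti.map e.ι 2 a + complexBetti.map φ.hom.hom.hom 2 (complexBetti.map e.ι 2 a))
      (QuotientGroup.mk q))
    {P E : Type*} [Field P] [Field E] [Algebra ℚ P] [Algebra ℚ E] [Algebra (weilField d) E]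
    [Algebra P E] [IsScalarTower ℚ (weilField d) E] [IsScalarTower ℚ P E]
    (hodd : Odd (Module.finrank ℚ P)) {z : E}
    (hz : Algebra.norm P z = algebraMap ℚ P ((q : ℚ) * (-1) ^ n)) :
    IsHyperbolicWeilType A φ n
      ((d : ℂ) • complexBetti.map e.ι 2 a + complexBetti.map φ.hom.hom.hom 2 (complexBetti.map e.ι 2 a)) := by
  haveI := fact_irreducible_weilPoly hd
  have hq0 : (q : ℚ) * (-1) ^ n ≠ 0 := mul_ne_zero (Units.ne_zero q) (pow_ne_zero _ (by norm_num))
  obtain ⟨w, hw⟩ := exists_norm_eq_of_odd_degree (F := ℚ) (K := weilField d) (P := P) (E := E)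
    (finrank_weilField d) hodd hq0 hz
  rw [weilNormResidue_mk_eq_split_of_norm (n := n) hd hw] at hδ
  exact isHyperbolicWeilType_of_hasWeilDiscriminantNondeg_split hn hA hd hφ e ha ha0 hweil hδ

/-- **Packaged: Weil type + odd-degree relative-norm witness of the discriminant ⟹ SPLIT Weil type**
(`HodgeTheory.IsSplitWeilType`), through `VanGeemen1994.IsWeilType.isSplitWeilType_of_hasWeilDiscriminantNondeg_split`.
This is the carrier form of "Schoen-algebraic ⟹ split" (WEIL-CELLS §R14, Theorem D) once the topological half
has produced the witness `z`. [cite: vanGeemen1994HodgeAV, 5.4 and (5.4.1)] [cite: Landherr1936HermitianForms] -/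
theorem isSplitWeilType_of_hasWeilDiscriminantNondeg_of_oddDegreeNorm (hW : IsWeilType A φ n d)
    (e : ProjectiveEmbedding A.X) {a : complexBetti (projectiveSpace e.n ℂ) 2} (ha : IsRationalClass a)
    (ha0 : a ≠ 0) {q : ℚˣ}
    (hδ : HasWeilDiscriminantNondeg A φ n d
      ((d : ℂ) • complexBetti.map e.ι 2 a + complexBetti.map φ.hom.hom.hom 2 (complexBetti.map e.ι 2 a))
      (QuotientGroup.mk q))
    {P E : Type*} [Field P] [Field E] [Algebra ℚ P] [Algebra ℚ E] [Algebra (weilField d) E]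
    [Algebra P E] [IsScalarTower ℚ (weilField d) E] [IsScalarTower ℚ P E]
    (hodd : Odd (Module.finrank ℚ P)) {z : E}
    (hz : Algebra.norm P z = algebraMap ℚ P ((q : ℚ) * (-1) ^ n)) :
    IsSplitWeilType A φ n d := by
  haveI := fact_irreducible_weilPoly hW.d_pos
  have hq0 : (q : ℚ) * (-1) ^ n ≠ 0 := mul_ne_zero (Units.ne_zero q) (pow_ne_zero _ (by norm_num))
  obtain ⟨w, hw⟩ := exists_norm_eq_of_odd_degree (F := ℚ) (K := weilField d) (P := P) (E := E)
    (finrank_weilField d) hodd hq0 hz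
  rw [weilNormResidue_mk_eq_split_of_norm (n := n) hW.d_pos hw] at hδ
  exact VanGeemen1994.IsWeilType.isSplitWeilType_of_hasWeilDiscriminantNondeg_split hW e ha ha0 hδ

/-- **Contrapositive (the located obstruction of WEIL-CELLS §R14 in carrier language).** On an abelian variety
of NON-split Weil type no non-degenerate discriminant witness `q` (for any `K`-symmetrised hyperplane class) has
`(-1)ⁿ q` equal to a relative norm `N_{E/P}(z)` with `ℚ ⊂ K_d ⊂ E ⊃ P ⊃ ℚ`, `[P : ℚ]` odd — in particular (paper
level, §R14) it is never the Hecke–Prym piece of a `ℤ/p ⋊ C_{(p-1)/2}`-curve, `p ≡ 3 (4)`, with Schoen-admissible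
cyclic branch data. [cite: vanGeemen1994HodgeAV, 5.4 and (5.4.1)] [cite: Landherr1936HermitianForms] -/
theorem IsNonsplitWeilType.not_oddDegreeNorm_discriminant (hN : IsNonsplitWeilType A φ n d)
    (e : ProjectiveEmbedding A.X) {a : complexBetti (projectiveSpace e.n ℂ) 2} (ha : IsRationalClass a)
    (ha0 : a ≠ 0) {q : ℚˣ}
    (hδ : HasWeilDiscriminantNondeg A φ n d
      ((d : ℂ) • complexBetti.map e.ι 2 a + complexBetti.map φ.hom.hom.hom 2 (complexBetti.map e.ι 2 a))
      (QuotientGroup.mk q))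
    {P E : Type*} [Field P] [Field E] [Algebra ℚ P] [Algebra ℚ E] [Algebra (weilField d) E]
    [Algebra P E] [IsScalarTower ℚ (weilField d) E] [IsScalarTower ℚ P E]
    (hodd : Odd (Module.finrank ℚ P)) (z : E) :
    Algebra.norm P z ≠ algebraMap ℚ P ((q : ℚ) * (-1) ^ n) := fun hz ↦
  (isSplitWeilType_of_hasWeilDiscriminantNondeg_of_oddDegreeNorm hN.isWeilType e ha ha0 hδ hodd
    hz).not_isNonsplitWeilType hN

end Carriers

end Summit.HodgeConjecture.HodgeConjecture.Ring2.AbelianAll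

end
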